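import Mathlib
import Summits.MatrixMultiplication.MatrixMultiplication.Theorems.SnSubsetDichotomyPolynomialSlackFerrersOverlap
import Summits.MatrixMultiplication.MatrixMultiplication.Theorems.SnSubsetDichotomyPolynomialSlackPositionRatio

/-!
# Per-position kept bound of the all-split endgame

Crux `Summit.MatrixMultiplication.MatrixMultiplication.Theses.SnSubsetDichotomy.PolynomialSlack`
(item `stmt-MatrixMultiplication-8306`), level-one programme, line transport-split-hull (lead c9):
the abstract per-position inequality `position_kept_bound` (F3-core) of the all-split endgame.
At a hub position the T-levels `a` (masses `σ a ≤ σ' a`, block sizes `x a`) and S-levels `b`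
(masses `ρ b ≤ ρ' b`, block sizes `y b`) carry pair hub masses `h a b` and pair kept values
`c a b`; the theorem bounds `∑ c` by `0.74 ·` (entropy cost of the included levels) plus a slop.

Proof. STEP A classifies the pairs: `∑ c ≤ E - Pen + ε₂ (∑σ')(∑ρ') + 2 ε₁ m (∑σ' + ∑ρ')`, with
`E` the productive (depleted, included) mass and `Pen` the penalty of the `T`-pairs (`hpen`).
STEP B is the Ferrers/overlap lemma `sum_mul_le_of_threshold_overlap` on the included levels:
`E + Ho² / 2 ≤ X Y`, `Ho` the included overlap outside the small-area relation.  STEP C: by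
Cauchy–Schwarz over the `≤ m²` pairs the penalty dominates `24.6 Hi²`, `Hi` the included overlap
on `T`-pairs.  STEP D: the budget gives `X + Y ≤ 1 + Ho + Hi + s` with `0 ≤ s ≤ m² h₁`,
`s ≤ ∑ σ'`.  STEP F: productive pairs have rates summing to `≥ 0.99`, whence
`E ≤ 2 max(X,Y) (cost - 0.245 (X+Y))`.  STEPS E–G (`real_core`) are the scalar endgame:
`position_ratio_le` applied to `K := E - Pen - 0.98 (Ho + Hi) s - 0.49 s²`.
The hypothesis `hnohub` and the lower rate bounds belong to the registered signature but are not
needed (`hpen` does not exclude depleted pairs).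
-/

namespace Summit.MatrixMultiplication.MatrixMultiplication.Theorems.PolynomialSlack

-- the namespace repeats `MatrixMultiplication` (summit = problem), as in the sibling files
set_option linter.dupNamespace false

open scoped BigOperators

/-- STEPS E–G of `position_kept_bound`, the scalar endgame: from the classification bound `hA`, the
Ferrers bound `hB`, the penalty bound `hC`, the budget `hD`, the sizes of the three parts
`Ho, Hi, s` of the included overlap and the cost bound `hF`, conclude `SC ≤ 0.74 (cA + cB) + slop`
via `position_ratio_le` for `max X Y`, `min X Y`, `H := Ho + Hi + s`,
`K := E - Pen - 0.98 (Ho + Hi) s - 0.49 s²`. -/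
private theorem real_core {SC E Pen SX SY X Y Ho Hi s cA cB ε₂ T B : ℝ}
    (hA : SC ≤ E - Pen + ε₂ * (SX * SY) + T) (hB : E + Ho ^ 2 / 2 ≤ X * Y)
    (hC : 246 / 10 * Hi ^ 2 ≤ Pen) (hD : X + Y ≤ 1 + (Ho + Hi + s)) (hs0 : 0 ≤ s) (hsB : s ≤ B)
    (hsX : s ≤ SX) (hHo : 0 ≤ Ho) (hHi : 0 ≤ Hi) (hHX : Ho + Hi ≤ SX) (hSY : 0 ≤ SY)
    (hB0 : 0 ≤ B) (hF : E ≤ 2 * ((cA - 245 / 1000 * X) * Y + X * (cB - 245 / 1000 * Y)))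
    (hcA : 245 / 1000 * X ≤ cA) (hcB : 245 / 1000 * Y ≤ cB) (hX : 0 ≤ X) (hY : 0 ≤ Y) :
    SC ≤ 74 / 100 * (cA + cB) + (ε₂ * (SX * SY) + T + 2 * (SX + SY) * B) := by
  -- the corrected kept mass `K` satisfies `K ≤ X Y - 0.49 H²` for `H := Ho + Hi + s`
  set K := E - Pen - 98 / 100 * (Ho + Hi) * s - 49 / 100 * s ^ 2 with hKdef
  have hK : K ≤ X * Y - 49 / 100 * (Ho + Hi + s) ^ 2 := by
    linarith [sq_nonneg (Ho - 49 * Hi), sq_nonneg Hi]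
  -- the correction is paid by the slop
  have hslop : 98 / 100 * (Ho + Hi) * s + 49 / 100 * s ^ 2 ≤ 2 * (SX + SY) * B := by
    have h1 : (Ho + Hi) * s ≤ SX * B := mul_le_mul hHX hsB hs0 ((add_nonneg hHo hHi).trans hHX)
    have h2 : s ^ 2 ≤ SX * B := by rw [sq]; exact mul_le_mul hsX hsB hs0 (hs0.trans hsX)
    linarith [mul_nonneg hSY hB0, sq_nonneg s]
  have hc0 : 0 ≤ cA + cB := by linarith
  have hKE : K ≤ E := by linarith [sq_nonneg Hi, mul_nonneg (add_nonneg hHo hHi) hs0, sq_nonneg s]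
  rcases lt_or_ge K 0 with hneg | hK0
  · linarith
  -- main case `0 ≤ K`: order `X, Y` as `W ≤ Z` and apply `position_ratio_le`
  obtain ⟨Z, W, hW0, hWZ, hZW, hZWm, hXZ, hYZ⟩ : ∃ Z W : ℝ,
      0 ≤ W ∧ W ≤ Z ∧ Z + W = X + Y ∧ Z * W = X * Y ∧ X ≤ Z ∧ Y ≤ Z := by
    rcases le_total X Y with hle | hle
    · exact ⟨Y, X, hX, hle, by ring, by ring, hle, le_rfl⟩
    · exact ⟨X, Y, hY, hle, rfl, rfl, le_rfl, hle⟩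
  have hEZ : E ≤ 2 * Z * (cA + cB - 245 / 1000 * (X + Y)) := by
    have h1 : (cA - 245 / 1000 * X) * Y ≤ (cA - 245 / 1000 * X) * Z :=
      mul_le_mul_of_nonneg_left hYZ (by linarith)
    have h2 : X * (cB - 245 / 1000 * Y) ≤ Z * (cB - 245 / 1000 * Y) :=
      mul_le_mul_of_nonneg_right hXZ (by linarith)
    linarith
  have hcost : 49 / 200 * (Z + W) + 1 / 2 * K / Z ≤ cA + cB := by
    rcases (hX.trans hXZ).eq_or_lt with hZ0 | hZpos
    · rw [← hZ0, div_zero]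
      linarith
    · have : 1 / 2 * K / Z ≤ cA + cB - 245 / 1000 * (X + Y) := by
        rw [div_le_iff₀ hZpos]
        linarith
      linarith
  have := position_ratio_le Z W (Ho + Hi + s) K (cA + cB) hW0 hWZ (by linarith) hK0 (by linarith)
    (by rw [hZWm]; exact hK) hcost
  linarith

/-- The body of `position_kept_bound`, with the inclusion predicates `IA, IB` of the T- and
S-levels and the penalised relation `T` (substantial small hub pairs) abstracted: all the proof
uses about them is that depleted pairs of substantial levels are included (`hI`), that `T`-pairs
are anti-kept (`hTc`) and small (`hTs`), that included small non-`T` pairs have hub mass `≤ h₁`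
(`hTn`), and the upper rate bounds of the included levels (`hrx`, `hry`). -/
private theorem core {m : ℕ} (σ σ' x ρ ρ' y : Fin m → ℝ) (h c : Fin m → Fin m → ℝ)
    (Dep T : Fin m → Fin m → Prop) [DecidableRel Dep] [DecidableRel T] (IA IB : Fin m → Prop)
    [DecidablePred IA] [DecidablePred IB] (ε₁ ε₂ h₁ M A₀ Lg : ℝ) (hε₁ : 0 < ε₁) (hε₂ : 0 < ε₂)
    (hh₁ : 0 ≤ h₁) (hLg : 0 < Lg) (hM : 56 * ((m : ℝ) * m) ≤ M)
    (hA₀ : Real.log A₀ ≤ 101 / 100 * Lg) (hx : ∀ a, 1 ≤ x a) (hy : ∀ b, 1 ≤ y b)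
    (hσ : ∀ a, 0 ≤ σ a ∧ σ a ≤ σ' a ∧ 15 / 16 * σ' a ≤ σ a)
    (hρ : ∀ b, 0 ≤ ρ b ∧ ρ b ≤ ρ' b ∧ 15 / 16 * ρ' b ≤ ρ b) (hh0 : ∀ a b, 0 ≤ h a b)
    (hhσ : ∀ a, ∑ b, h a b ≤ σ' a) (hhρ : ∀ b, ∑ a, h a b ≤ ρ' b)
    (hbudget : ∀ P Q : Finset (Fin m),
      ∑ a ∈ P, σ' a + ∑ b ∈ Q, ρ' b ≤ 1 + ∑ a ∈ P, ∑ b ∈ Q, h a b)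
    (hc : ∀ a b, c a b ≤ σ' a * ρ' b) (hcdep : ∀ a b, ¬ Dep a b → c a b ≤ ε₂ * σ a * ρ b)
    (hsmall : ∀ a b, Dep a b → x a * y b ≤ A₀)
    (hI : ∀ a b, ε₁ ≤ σ a → ε₁ ≤ ρ b → Dep a b → IA a ∧ IB b)
    (hTc : ∀ a b, T a b → c a b ≤ -(M / 2) * σ a * ρ b) (hTs : ∀ a b, T a b → x a * y b ≤ A₀)
    (hTn : ∀ a b, IA a → IB b → x a * y b ≤ A₀ → ¬ T a b → h a b ≤ h₁)
    (hrx : ∀ a, IA a → Real.log (x a) ≤ 755 / 1000 * Lg)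
    (hry : ∀ b, IB b → Real.log (y b) ≤ 755 / 1000 * Lg) :
    ∑ a, ∑ b, c a b ≤ 74 / 100 * ((∑ a, if IA a then σ' a * (1 - Real.log (x a) / Lg) else 0)
        + (∑ b, if IB b then ρ' b * (1 - Real.log (y b) / Lg) else 0))
      + (ε₂ * ((∑ a, σ' a) * (∑ b, ρ' b)) + 2 * ε₁ * m * ((∑ a, σ' a) + (∑ b, ρ' b))
        + 2 * ((∑ a, σ' a) + (∑ b, ρ' b)) * ((m : ℝ) * m * h₁)) := by
  -- basic signs
  have hσ'0 : ∀ a, 0 ≤ σ' a := fun a => (hσ a).1.trans (hσ a).2.1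
  have hρ'0 : ∀ b, 0 ≤ ρ' b := fun b => (hρ b).1.trans (hρ b).2.1
  have hx0 : ∀ a, 0 < x a := fun a => one_pos.trans_le (hx a)
  have hy0 : ∀ b, 0 < y b := fun b => one_pos.trans_le (hy b)
  have hhσ' : ∀ a b, h a b ≤ σ' a := fun a b =>
    (Finset.single_le_sum (f := fun b' => h a b') (fun b' _ => hh0 a b') (Finset.mem_univ b)).trans
      (hhσ a)
  have hhρ' : ∀ a b, h a b ≤ ρ' b := fun a b =>
    (Finset.single_le_sum (f := fun a' => h a' b) (fun a' _ => hh0 a' b) (Finset.mem_univ a)).trans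
      (hhρ b)
  -- STEP D (first half): the budget on the included levels
  have hD := hbudget (Finset.univ.filter IA) (Finset.univ.filter IB)
  simp only [Finset.sum_filter] at hD
  -- included masses and costs, the included overlap kernel `G` and its `T`/rest parts
  set σ₁ : Fin m → ℝ := fun a => if IA a then σ' a else 0 with hσ₁
  set ρ₁ : Fin m → ℝ := fun b => if IB b then ρ' b else 0 with hρ₁
  set u : Fin m → ℝ := fun a => if IA a then σ' a * (1 - Real.log (x a) / Lg) else 0 with hu
  set v : Fin m → ℝ := fun b => if IB b then ρ' b * (1 - Real.log (y b) / Lg) else 0 with hv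
  set G : Fin m → Fin m → ℝ := fun a b => if IA a ∧ IB b then h a b else 0 with hG
  set gi : Fin m → Fin m → ℝ := fun a b => if T a b then G a b else 0 with hgi
  set r : Fin m → Fin m → ℝ := fun a b => if x a * y b ≤ A₀ ∧ ¬ T a b then G a b else 0 with hr
  clear_value σ₁ ρ₁ u v G gi r
  have hσ₁0 : ∀ a, 0 ≤ σ₁ a := fun a => by simp only [hσ₁]; split_ifs; exacts [hσ'0 a, le_rfl]
  have hρ₁0 : ∀ b, 0 ≤ ρ₁ b := fun b => by simp only [hρ₁]; split_ifs; exacts [hρ'0 b, le_rfl]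
  have hG0 : ∀ a b, 0 ≤ G a b := fun a b => by simp only [hG]; split_ifs; exacts [hh0 a b, le_rfl]
  have hGle : ∀ a b, G a b ≤ h a b :=
    fun a b => by simp only [hG]; split_ifs; exacts [le_rfl, hh0 a b]
  have hgi0 : ∀ a b, 0 ≤ gi a b :=
    fun a b => by simp only [hgi]; split_ifs; exacts [hG0 a b, le_rfl]
  have hr0 : ∀ a b, 0 ≤ r a b := fun a b => by simp only [hr]; split_ifs; exacts [hG0 a b, le_rfl]
  -- STEP A: classification of the pairs
  have hstepA : ∑ a, ∑ b, c a b ≤ (∑ a, ∑ b, if Dep a b then σ₁ a * ρ₁ b else 0)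
      - (∑ a, ∑ b, if T a b then M / 2 * (σ a * ρ b) else 0)
      + ε₂ * ((∑ a, σ' a) * (∑ b, ρ' b)) + 2 * ε₁ * m * ((∑ a, σ' a) + (∑ b, ρ' b)) := by
    have hpt : ∀ a b, c a b ≤ (if Dep a b then σ₁ a * ρ₁ b else 0)
        - (if T a b then M / 2 * (σ a * ρ b) else 0)
        + ε₂ * (σ' a * ρ' b) + (2 * ε₁ * ρ' b + 2 * ε₁ * σ' a) := by
      intro a b
      obtain ⟨hσ0, hσle, hσ15⟩ := hσ a
      obtain ⟨hρ0, hρle, hρ15⟩ := hρ b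
      have h1 : 0 ≤ (if Dep a b then σ₁ a * ρ₁ b else 0) := by
        split_ifs; exacts [mul_nonneg (hσ₁0 a) (hρ₁0 b), le_rfl]
      have h2 : 0 ≤ ε₂ * (σ' a * ρ' b) := mul_nonneg hε₂.le (mul_nonneg (hσ'0 a) (hρ'0 b))
      have h3 : 0 ≤ 2 * ε₁ * ρ' b := mul_nonneg (by linarith) (hρ'0 b)
      have h4 : 0 ≤ 2 * ε₁ * σ' a := mul_nonneg (by linarith) (hσ'0 a)
      by_cases hT : T a b
      · rw [if_pos hT]; linarith [hTc a b hT]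
      rw [if_neg hT, sub_zero]
      by_cases ha : ε₁ ≤ σ a
      · by_cases hb : ε₁ ≤ ρ b
        · by_cases hd : Dep a b
          · obtain ⟨hia, hib⟩ := hI a b ha hb hd
            have : σ₁ a * ρ₁ b = σ' a * ρ' b := by simp only [hσ₁, hρ₁, if_pos hia, if_pos hib]
            rw [if_pos hd]; linarith [hc a b]
          · have h6 : ε₂ * σ a * ρ b ≤ ε₂ * (σ' a * ρ' b) := by
              rw [mul_assoc]
              exact mul_le_mul_of_nonneg_left (mul_le_mul hσle hρle hρ0 (hσ'0 a)) hε₂.le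
            linarith [hcdep a b hd]
        · have h5 : ρ' b ≤ 2 * ε₁ := by linarith [not_le.1 hb]
          have h6 : σ' a * ρ' b ≤ σ' a * (2 * ε₁) := mul_le_mul_of_nonneg_left h5 (hσ'0 a)
          linarith [hc a b]
      · have h5 : σ' a ≤ 2 * ε₁ := by linarith [not_le.1 ha]
        have h6 : σ' a * ρ' b ≤ 2 * ε₁ * ρ' b := mul_le_mul_of_nonneg_right h5 (hρ'0 b)
        linarith [hc a b]
    calc ∑ a, ∑ b, c a b ≤ ∑ a, ∑ b, ((if Dep a b then σ₁ a * ρ₁ b else 0)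
          - (if T a b then M / 2 * (σ a * ρ b) else 0)
          + ε₂ * (σ' a * ρ' b) + (2 * ε₁ * ρ' b + 2 * ε₁ * σ' a)) :=
          Finset.sum_le_sum fun a _ => Finset.sum_le_sum fun b _ => hpt a b
      _ = _ := by
          simp only [Finset.sum_add_distrib, Finset.sum_sub_distrib, ← Finset.mul_sum,
            ← Finset.sum_mul, Finset.sum_const, Finset.card_univ, Fintype.card_fin, nsmul_eq_mul]
          ring
  -- STEP B: the Ferrers/overlap lemma on the included levels
  have hGσ : ∀ a, ∑ b, G a b ≤ σ₁ a := fun a => by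
    by_cases ha : IA a
    · simpa only [hσ₁, if_pos ha] using (Finset.sum_le_sum fun b _ => hGle a b).trans (hhσ a)
    · simp [hσ₁, hG, ha]
  have hGρ : ∀ b, ∑ a, G a b ≤ ρ₁ b := fun b => by
    by_cases hb : IB b
    · simpa only [hρ₁, if_pos hb] using (Finset.sum_le_sum fun a _ => hGle a b).trans (hhρ b)
    · simp [hρ₁, hG, hb]
  have hB : (∑ a, ∑ b, if Dep a b then σ₁ a * ρ₁ b else 0)
      + (∑ a, ∑ b, if x a * y b ≤ A₀ then 0 else G a b) ^ 2 / 2 ≤ (∑ a, σ₁ a) * (∑ b, ρ₁ b) := by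
    have hE : (∑ a, ∑ b, if Dep a b then σ₁ a * ρ₁ b else 0)
        ≤ ∑ a, ∑ b, (if x a * y b ≤ A₀ then σ₁ a * ρ₁ b else 0) := by
      refine Finset.sum_le_sum fun a _ => Finset.sum_le_sum fun b _ => ?_
      by_cases hd : Dep a b
      · rw [if_pos hd, if_pos (hsmall a b hd)]
      · rw [if_neg hd]; split_ifs; exacts [mul_nonneg (hσ₁0 a) (hρ₁0 b), le_rfl]
    linarith [sum_mul_le_of_threshold_overlap x y A₀ hx0 hy0 σ₁ ρ₁ G hG0 hGσ hGρ]
  -- STEP C: the penalty dominates `24.6 · Hi²`, by Cauchy–Schwarz over the `≤ m·m` pairs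
  have hC1 : ∀ a b, M / 2 * (225 / 256) * gi a b ^ 2
      ≤ (if T a b then M / 2 * (σ a * ρ b) else 0) := by
    intro a b
    obtain ⟨hσ0, hσle, hσ15⟩ := hσ a
    obtain ⟨hρ0, hρle, hρ15⟩ := hρ b
    simp only [hgi]
    split_ifs with ht
    · have h3 : G a b ^ 2 ≤ σ' a * ρ' b := by
        rw [sq]
        exact mul_le_mul ((hGle a b).trans (hhσ' a b)) ((hGle a b).trans (hhρ' a b)) (hG0 a b)
          (hσ'0 a)
      have h4 : 15 / 16 * σ' a * (15 / 16 * ρ' b) ≤ σ a * ρ b :=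
        mul_le_mul hσ15 hρ15 (by linarith [hρ'0 b]) hσ0
      have hM0 : 0 ≤ M / 2 := by linarith [mul_self_nonneg (m : ℝ)]
      have h5 : 225 / 256 * G a b ^ 2 ≤ σ a * ρ b := by linarith
      linarith [mul_le_mul_of_nonneg_left h5 hM0]
    · simp
  have hC2 : M / 2 * (225 / 256) * ∑ a, ∑ b, gi a b ^ 2
      ≤ ∑ a, ∑ b, (if T a b then M / 2 * (σ a * ρ b) else 0) := by
    rw [Finset.mul_sum]
    refine Finset.sum_le_sum fun a _ => ?_
    rw [Finset.mul_sum]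
    exact Finset.sum_le_sum fun b _ => hC1 a b
  have hCS : (∑ a, ∑ b, gi a b) ^ 2 ≤ (m : ℝ) * m * ∑ a, ∑ b, gi a b ^ 2 := by
    have h1 : (∑ a, ∑ b, gi a b) ^ 2 ≤ m * ∑ a, (∑ b, gi a b) ^ 2 := by
      simpa [Finset.card_univ, Fintype.card_fin] using
        sq_sum_le_card_mul_sum_sq (s := Finset.univ) (f := fun a => ∑ b, gi a b)
    have h2 : ∀ a, (∑ b, gi a b) ^ 2 ≤ m * ∑ b, gi a b ^ 2 := fun a => by
      simpa [Finset.card_univ, Fintype.card_fin] using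
        sq_sum_le_card_mul_sum_sq (s := Finset.univ) (f := fun b => gi a b)
    calc (∑ a, ∑ b, gi a b) ^ 2 ≤ m * ∑ a, (∑ b, gi a b) ^ 2 := h1
      _ ≤ m * ∑ a, (m * ∑ b, gi a b ^ 2) :=
          mul_le_mul_of_nonneg_left (Finset.sum_le_sum fun a _ => h2 a) (Nat.cast_nonneg m)
      _ = _ := by rw [← Finset.mul_sum]; ring
  have hC : 246 / 10 * (∑ a, ∑ b, gi a b) ^ 2
      ≤ ∑ a, ∑ b, (if T a b then M / 2 * (σ a * ρ b) else 0) := by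
    have hS0 : 0 ≤ ∑ a, ∑ b, gi a b ^ 2 :=
      Finset.sum_nonneg fun a _ => Finset.sum_nonneg fun b _ => sq_nonneg _
    have h1 : 56 * ((m : ℝ) * m) * ∑ a, ∑ b, gi a b ^ 2 ≤ M * ∑ a, ∑ b, gi a b ^ 2 :=
      mul_le_mul_of_nonneg_right hM hS0
    linarith [mul_nonneg (mul_self_nonneg (m : ℝ)) hS0]
  -- STEP D (second half): `∑∑ G = Ho + Hi + s`, `s ≤ m·m·h₁`, `∑∑ G ≤ ∑ σ'`
  have hGsum : (∑ a, if IA a then (∑ b, if IB b then h a b else 0) else 0) = ∑ a, ∑ b, G a b := by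
    refine Finset.sum_congr rfl fun a _ => ?_
    by_cases ha : IA a
    · rw [if_pos ha]; exact Finset.sum_congr rfl fun b _ => by simp [hG, ha]
    · rw [if_neg ha]; exact (Finset.sum_eq_zero fun b _ => by simp [hG, ha]).symm
  have hsplit : ∀ a b, G a b = (if x a * y b ≤ A₀ then 0 else G a b) + gi a b + r a b := by
    intro a b
    simp only [hgi, hr]
    by_cases hs : x a * y b ≤ A₀
    · by_cases ht : T a b <;> simp [hs, ht]
    · have ht : ¬ T a b := fun ht => hs (hTs a b ht)
      simp [hs, ht]
  have hGsplit : ∑ a, ∑ b, G a b = (∑ a, ∑ b, if x a * y b ≤ A₀ then 0 else G a b)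
      + (∑ a, ∑ b, gi a b) + (∑ a, ∑ b, r a b) := by
    rw [show (∑ a, ∑ b, G a b)
        = ∑ a, ∑ b, ((if x a * y b ≤ A₀ then 0 else G a b) + gi a b + r a b) from
      Finset.sum_congr rfl fun a _ => Finset.sum_congr rfl fun b _ => hsplit a b]
    simp only [Finset.sum_add_distrib]
  rw [hGsum, hGsplit] at hD
  have hGX : ∑ a, ∑ b, G a b ≤ ∑ a, σ' a :=
    Finset.sum_le_sum fun a _ => (Finset.sum_le_sum fun b _ => hGle a b).trans (hhσ a)
  have hHo0 : 0 ≤ ∑ a, ∑ b, (if x a * y b ≤ A₀ then 0 else G a b) :=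
    Finset.sum_nonneg fun a _ => Finset.sum_nonneg fun b _ => by
      split_ifs; exacts [le_rfl, hG0 a b]
  have hnn : ∀ g : Fin m → Fin m → ℝ, (∀ a b, 0 ≤ g a b) → 0 ≤ ∑ a, ∑ b, g a b :=
    fun g hg => Finset.sum_nonneg fun a _ => Finset.sum_nonneg fun b _ => hg a b
  have hsB : ∑ a, ∑ b, r a b ≤ (m : ℝ) * m * h₁ := by
    have hr1 : ∀ a b, r a b ≤ h₁ := fun a b => by
      simp only [hr, hG]
      split_ifs with h1 h2; exacts [hTn a b h2.1 h2.2 h1.1 h1.2, hh₁, hh₁]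
    calc ∑ a, ∑ b, r a b ≤ ∑ a : Fin m, ∑ b : Fin m, h₁ :=
          Finset.sum_le_sum fun a _ => Finset.sum_le_sum fun b _ => hr1 a b
      _ = _ := by
          simp only [Finset.sum_const, Finset.card_univ, Fintype.card_fin, nsmul_eq_mul]; ring
  -- STEP F: productive pairs are paid by the entropy cost of the included levels
  have hu0 : ∀ a, 0 ≤ u a - 245 / 1000 * σ₁ a := fun a => by
    simp only [hu, hσ₁]
    split_ifs with ha
    · have h1 : Real.log (x a) / Lg ≤ 755 / 1000 := by rw [div_le_iff₀ hLg]; exact hrx a ha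
      linarith [mul_nonneg (hσ'0 a) (sub_nonneg.2 h1)]
    · simp
  have hv0 : ∀ b, 0 ≤ v b - 245 / 1000 * ρ₁ b := fun b => by
    simp only [hv, hρ₁]
    split_ifs with hb
    · have h1 : Real.log (y b) / Lg ≤ 755 / 1000 := by rw [div_le_iff₀ hLg]; exact hry b hb
      linarith [mul_nonneg (hρ'0 b) (sub_nonneg.2 h1)]
    · simp
  have hF1 : ∀ a b, (if Dep a b then σ₁ a * ρ₁ b else 0)
      ≤ 2 * ((u a - 245 / 1000 * σ₁ a) * ρ₁ b + σ₁ a * (v b - 245 / 1000 * ρ₁ b)) := by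
    intro a b
    have hR : 0 ≤ 2 * ((u a - 245 / 1000 * σ₁ a) * ρ₁ b + σ₁ a * (v b - 245 / 1000 * ρ₁ b)) := by
      linarith [mul_nonneg (hu0 a) (hρ₁0 b), mul_nonneg (hσ₁0 a) (hv0 b)]
    by_cases hd : Dep a b
    · rw [if_pos hd]
      by_cases hab : IA a ∧ IB b
      · obtain ⟨ha, hb⟩ := hab
        have hlog : Real.log (x a) + Real.log (y b) ≤ 101 / 100 * Lg := by
          rw [← Real.log_mul (hx0 a).ne' (hy0 b).ne']
          exact (Real.log_le_log (mul_pos (hx0 a) (hy0 b)) (hsmall a b hd)).trans hA₀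
        have hL : Real.log (x a) / Lg + Real.log (y b) / Lg ≤ 101 / 100 := by
          rw [← add_div, div_le_iff₀ hLg]; linarith
        have hP : 0 ≤ σ' a * ρ' b := mul_nonneg (hσ'0 a) (hρ'0 b)
        simp only [hu, hv, hσ₁, hρ₁, if_pos ha, if_pos hb]
        linarith [mul_le_mul_of_nonneg_left hL hP]
      · have h0 : σ₁ a * ρ₁ b = 0 := by
          simp only [hσ₁, hρ₁]
          rcases not_and_or.1 hab with h' | h' <;> simp [h']
        linarith
    · rw [if_neg hd]; exact hR
  have hF : (∑ a, ∑ b, if Dep a b then σ₁ a * ρ₁ b else 0)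
      ≤ 2 * (((∑ a, u a) - 245 / 1000 * ∑ a, σ₁ a) * (∑ b, ρ₁ b)
        + (∑ a, σ₁ a) * ((∑ b, v b) - 245 / 1000 * ∑ b, ρ₁ b)) := by
    calc (∑ a, ∑ b, if Dep a b then σ₁ a * ρ₁ b else 0)
          ≤ ∑ a, ∑ b, 2 * ((u a - 245 / 1000 * σ₁ a) * ρ₁ b
            + σ₁ a * (v b - 245 / 1000 * ρ₁ b)) :=
          Finset.sum_le_sum fun a _ => Finset.sum_le_sum fun b _ => hF1 a b
      _ = _ := by
          have e1 : (∑ a, u a) - 245 / 1000 * (∑ a, σ₁ a) = ∑ a, (u a - 245 / 1000 * σ₁ a) := by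
            rw [Finset.mul_sum, ← Finset.sum_sub_distrib]
          have e2 : (∑ b, v b) - 245 / 1000 * (∑ b, ρ₁ b) = ∑ b, (v b - 245 / 1000 * ρ₁ b) := by
            rw [Finset.mul_sum, ← Finset.sum_sub_distrib]
          rw [e1, e2, Finset.sum_mul_sum, Finset.sum_mul_sum, ← Finset.sum_add_distrib,
            Finset.mul_sum]
          refine Finset.sum_congr rfl fun a _ => ?_
          rw [← Finset.sum_add_distrib, Finset.mul_sum]
  have hcA : 245 / 1000 * (∑ a, σ₁ a) ≤ ∑ a, u a := by
    have := Finset.sum_nonneg fun a (_ : a ∈ Finset.univ) => hu0 a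
    rw [Finset.sum_sub_distrib, ← Finset.mul_sum] at this
    linarith
  have hcB : 245 / 1000 * (∑ b, ρ₁ b) ≤ ∑ b, v b := by
    have := Finset.sum_nonneg fun b (_ : b ∈ Finset.univ) => hv0 b
    rw [Finset.sum_sub_distrib, ← Finset.mul_sum] at this
    linarith
  -- STEP G: the scalar endgame
  have hHi0 := hnn gi hgi0
  have hs0 := hnn r hr0
  exact real_core hstepA hB hC hD hs0 hsB (by linarith) hHo0 hHi0 (by linarith)
    (Finset.sum_nonneg fun b _ => hρ'0 b) (mul_nonneg (mul_self_nonneg (m : ℝ)) hh₁) hF hcA hcB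
    (Finset.sum_nonneg fun a _ => hσ₁0 a) (Finset.sum_nonneg fun b _ => hρ₁0 b)

/-- **Per-position kept bound (F3-core of the all-split endgame).**  Level data on `Fin m`:
T-levels `a` with masses `σ a ≤ σ' a` (`15/16 σ' ≤ σ`) and block sizes `x a ≥ 1`, S-levels `b`
with `ρ, ρ', y`, pair hub masses `h a b ≥ 0` (row sums `≤ σ' a`, column sums `≤ ρ' b`,
sub-partition budget `hbudget`), pair kept values `c a b ≤ σ' a * ρ' b`, a depletion relation
`Dep`.  If non-depleted pairs keep `≤ ε₂ σ ρ` (`hcdep`), small-area hub pairs of substantial levels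
keep `≤ -(M/2) σ ρ`, `56 m² ≤ M` (`hpen`), depleted pairs have small area (`hsmall`) and the levels
of depleted substantial pairs have `log x, log y ∈ [0.245 Lg, 0.755 Lg]` (`hratex`, `hratey`),
then `∑ c ≤ 0.74 · cost + ε₂ (∑σ')(∑ρ') + 2 ε₁ m (∑σ' + ∑ρ') + 2 (∑σ' + ∑ρ') (m² h₁)`, `cost` the
entropy cost `∑ σ' (1 - log x / Lg) + ∑ ρ' (1 - log y / Lg)` of the included levels (substantial and
meeting a depleted pair with a substantial partner).  `hnohub` is not used by the proof. -/
theorem position_kept_bound {m : ℕ} (σ σ' x : Fin m → ℝ) (ρ ρ' y : Fin m → ℝ)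
    (h c : Fin m → Fin m → ℝ) (Dep : Fin m → Fin m → Prop) [DecidableRel Dep]
    (ε₁ ε₂ h₁ M A₀ Lg : ℝ) (hε₁ : 0 < ε₁) (hε₂ : 0 < ε₂) (hh₁ : 0 < h₁) (hLg : 0 < Lg)
    (hM : 56 * ((m : ℝ) * m) ≤ M) (hA₀ : Real.log A₀ ≤ 101 / 100 * Lg) (hx : ∀ a, 1 ≤ x a)
    (hy : ∀ b, 1 ≤ y b) (hσ : ∀ a, 0 ≤ σ a ∧ σ a ≤ σ' a ∧ 15 / 16 * σ' a ≤ σ a)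
    (hρ : ∀ b, 0 ≤ ρ b ∧ ρ b ≤ ρ' b ∧ 15 / 16 * ρ' b ≤ ρ b) (hh0 : ∀ a b, 0 ≤ h a b)
    (hhσ : ∀ a, ∑ b, h a b ≤ σ' a) (hhρ : ∀ b, ∑ a, h a b ≤ ρ' b)
    (hbudget : ∀ (P Q : Finset (Fin m)),
      ∑ a ∈ P, σ' a + ∑ b ∈ Q, ρ' b ≤ 1 + ∑ a ∈ P, ∑ b ∈ Q, h a b)
    (hc : ∀ a b, c a b ≤ σ' a * ρ' b) (hcdep : ∀ a b, ¬ Dep a b → c a b ≤ ε₂ * σ a * ρ b)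
    (hpen : ∀ a b, ε₁ ≤ σ a → ε₁ ≤ ρ b → h₁ ≤ h a b → x a * y b ≤ A₀ →
      c a b ≤ -(M / 2) * σ a * ρ b)
    (hnohub : ∀ a b, ε₁ ≤ σ a → ε₁ ≤ ρ b → Dep a b → h a b < h₁)
    (hsmall : ∀ a b, Dep a b → x a * y b ≤ A₀)
    (hratex : ∀ a, ε₁ ≤ σ a → (∃ b, ε₁ ≤ ρ b ∧ Dep a b) →
      245 / 1000 * Lg ≤ Real.log (x a) ∧ Real.log (x a) ≤ 755 / 1000 * Lg)
    (hratey : ∀ b, ε₁ ≤ ρ b → (∃ a, ε₁ ≤ σ a ∧ Dep a b) →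
      245 / 1000 * Lg ≤ Real.log (y b) ∧ Real.log (y b) ≤ 755 / 1000 * Lg) :
    ∑ a, ∑ b, c a b ≤ 74 / 100 * ((∑ a, if ε₁ ≤ σ a ∧ ∃ b, ε₁ ≤ ρ b ∧ Dep a b then
        σ' a * (1 - Real.log (x a) / Lg) else 0) + (∑ b, if ε₁ ≤ ρ b ∧ ∃ a, ε₁ ≤ σ a ∧ Dep a b
        then ρ' b * (1 - Real.log (y b) / Lg) else 0)) + (ε₂ * ((∑ a, σ' a) * (∑ b, ρ' b))
      + 2 * ε₁ * m * ((∑ a, σ' a) + (∑ b, ρ' b))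
      + 2 * ((∑ a, σ' a) + (∑ b, ρ' b)) * ((m : ℝ) * m * h₁)) := by
  have _hunused := hnohub
  exact core σ σ' x ρ ρ' y h c Dep
    (fun a b => ε₁ ≤ σ a ∧ ε₁ ≤ ρ b ∧ h₁ ≤ h a b ∧ x a * y b ≤ A₀)
    (fun a => ε₁ ≤ σ a ∧ ∃ b, ε₁ ≤ ρ b ∧ Dep a b) (fun b => ε₁ ≤ ρ b ∧ ∃ a, ε₁ ≤ σ a ∧ Dep a b)
    ε₁ ε₂ h₁ M A₀ Lg hε₁ hε₂ hh₁.le hLg hM hA₀ hx hy hσ hρ hh0 hhσ hhρ hbudget hc hcdep hsmall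
    (fun a b ha hb hd => ⟨⟨ha, b, hb, hd⟩, ⟨hb, a, ha, hd⟩⟩)
    (fun a b ht => hpen a b ht.1 ht.2.1 ht.2.2.1 ht.2.2.2) (fun a b ht => ht.2.2.2)
    (fun a b ha hb hs hnt => (not_le.1 fun hle => hnt ⟨ha.1, hb.1, hle, hs⟩).le)
    (fun a ha => (hratex a ha.1 ha.2).2) (fun b hb => (hratey b hb.1 hb.2).2)

end Summit.MatrixMultiplication.MatrixMultiplication.Theorems.PolynomialSlack
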